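import Summits.NavierStokesRegularity.NavierStokesRegularity.Theses.RootDecompFrontierFloor
import Summits.NavierStokesRegularity.NavierStokesRegularity.Theses.RootDecompFrostmanHorizon
import Summits.NavierStokesRegularity.NavierStokesRegularity.Theorems.QuarterJoltTypeIEnergyEquality

/-!
# `RootDecompFrontierFloor` — EXACTNESS certificate of the recut and domination bookkeeping (decomp-ns node N33, writer g29)

Kernel record of the root-decomposition node N33 (lens-1 g4 «TAME-FRONTIER RECUT»), a child of
`RootDecompIntermittency` (N8) at its declared residual X₂ `NoThickFrontierBlowup` (stmt-NavierStokesRegularity-27234),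
recut against `RootDecompTerminalEnergy` (N1):

* `noThickFrontierBlowup_iff_recut` — RESIDUAL-MODE EXACTNESS: relative to N1's tame cells E₂ `NoTameTypeII` (stmt-24828)
  and P1 `NoTypeIBlowup` (stmt-1217), N8's residual X₂ is EQUIVALENT to the new residual W₂
  `RootDecompFrontierFloor.NoWildBlobBlowup` (stmt-27237); `recut_certificate` packages `X₂ → W₂` (unconditional) and the glue
  `W₂ → E₂ → P1 → X₂`. Stated between OPEN items as `Iff`/conjunctions (certificate shape; it closes nothing).
* `noWildBlobBlowup_iff_offTypeI` — W₂ is TYPE-I-FREE: adding the hypothesis `¬ IsTypeIBlowup u T` does not change it, by the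
  tree theorem `Theorems.NoTerminalJolt.tendsto_eLpNorm_sub_of_isTypeIBlowup` (a Type-I first blow-up is tame)
  [cite: LeslieShvydkoy2017, Theorem 1.2].
* `domination_certificate` — DOMINATION: W₂ follows from N1's wild items P2 `NoEnergyAtom` (stmt-24827) ∧ J1
  `AtomFreeBlowupIsTame` (stmt-24829), hence from N32's P2 ∧ A `LinearLocalDefect` ∧ B `LinearDefectIsTame`.
* `phiLine_certificate` — the Φ-LINE of X₁ (stmt-27233) composes: Φ `TameHasBlobFrontier` (stmt-27239) and N1's P2 ∧ J1
  give X₁ (the registered skeleton `Cruxes.NoThinFrontierBlowup.FrontierFloor` in arrow form); under Φ every Type-I first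
  blow-up has a blob frontier.

No `def`s; nothing here proves NS regularity (rung 0).
-/

set_option linter.dupNamespace false

namespace Summit.NavierStokesRegularity.NavierStokesRegularity.Theorems.RootDecompFrontierFloorExactness

open scoped Topology ENNReal NNReal
open Filter Set MeasureTheory
open Literature.Analysis.FluidPDE
open Summit.NavierStokesRegularity.NavierStokesRegularity.Theses.RootDecompTerminalEnergy
  (NoTameTypeII NoTypeIBlowup NoEnergyAtom AtomFreeBlowupIsTame)
open Summit.NavierStokesRegularity.NavierStokesRegularity.Theses.RootDecompIntermittency (NoThickFrontierBlowup)
open Summit.NavierStokesRegularity.NavierStokesRegularity.Theses.RootDecompFrostmanHorizon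
  (LinearLocalDefect LinearDefectIsTame)
open Summit.NavierStokesRegularity.NavierStokesRegularity.Theses.RootDecompFrontierFloor
  (NoWildBlobBlowup TameHasBlobFrontier)

/-! ## The recut `X₂ ⟺ W₂` relative to N1's tame cells (certificate shape: `Iff` / conjunctions only) -/

/-- RESIDUAL-MODE EXACTNESS of node N33: relative to N1's `E₂ ∧ P1`, N8's residual X₂ ⟺ the new residual W₂.
(`→`: W₂ is X₂ with one more hypothesis; `←`: excluded middle on tameness of the maximal solution — tame ∧ Type II is
excluded by E₂, tame ∧ Type I extends by P1, wild extends by W₂.) -/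
theorem noThickFrontierBlowup_iff_recut (h₃ : NoTameTypeII) (h₄ : NoTypeIBlowup) :
    NoThickFrontierBlowup ↔ NoWildBlobBlowup := by
  refine ⟨fun h ν T hν hT u p hcl hLH hdec hthick _ => h ν T hν hT u p hcl hLH hdec hthick, fun h₂ => ?_⟩
  intro ν T hν hT u p hcl hLH hdec hthick
  by_contra hext
  by_cases htame : Filter.Tendsto (fun t => MeasureTheory.eLpNorm (u t - u T) 2 MeasureTheory.volume)
      (nhdsWithin T (Set.Iio T)) (nhds 0)
  · exact hext (h₄ ν T hν hT u p hcl hLH hdec (h₃ ν T hν hT u p ⟨hcl, hext⟩ hLH hdec htame))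
  · exact hext (h₂ ν T hν hT u p hcl hLH hdec hthick htame)

/-- The two directions of the recut packaged unconditionally: `X₂ → W₂` outright, and `W₂ → E₂ → P1 → X₂` (the glue). -/
theorem recut_certificate :
    (NoThickFrontierBlowup → NoWildBlobBlowup) ∧ (NoWildBlobBlowup → NoTameTypeII → NoTypeIBlowup → NoThickFrontierBlowup) :=
  ⟨fun h ν T hν hT u p hcl hLH hdec hthick _ => h ν T hν hT u p hcl hLH hdec hthick,
    fun h₂ h₃ h₄ => (noThickFrontierBlowup_iff_recut h₃ h₄).2 h₂⟩

/-! ## W₂ is TYPE-I-FREE (Leslie–Shvydkoy Thm 1.2, tree theorem) -/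

/-- A Type-I first blow-up of a rapidly decaying smooth Leray–Hopf flow is tame (tree theorem, restated in the frame). -/
theorem tame_of_isTypeIBlowup {ν T : ℝ} (hν : 0 < ν) (hT : 0 < T)
    {u : ℝ → EuclideanSpace ℝ (Fin 3) → EuclideanSpace ℝ (Fin 3)} {p : ℝ → EuclideanSpace ℝ (Fin 3) → ℝ}
    (hcl : IsClassicalNSSolutionOn (Set.Ico 0 T) ν 0 u p) (hLH : IsLerayHopfOn T ν 0 (u 0) u)
    (hdec : HasRapidSpatialDecay (u 0)) (hTI : IsTypeIBlowup u T) :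
    Filter.Tendsto (fun t => MeasureTheory.eLpNorm (u t - u T) 2 MeasureTheory.volume)
      (nhdsWithin T (Set.Iio T)) (nhds 0) :=
  Summit.NavierStokesRegularity.NavierStokesRegularity.Theorems.NoTerminalJolt.tendsto_eLpNorm_sub_of_isTypeIBlowup
    hν hT hcl hLH hdec hTI

/-- W₂ is Type-I-free: the Type-I cell is already tame, so excluding it from W₂'s frame changes nothing. -/
theorem noWildBlobBlowup_iff_offTypeI : NoWildBlobBlowup ↔
    (∀ (ν T : ℝ), 0 < ν → 0 < T → ∀ (u : ℝ → EuclideanSpace ℝ (Fin 3) → EuclideanSpace ℝ (Fin 3))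
      (p : ℝ → EuclideanSpace ℝ (Fin 3) → ℝ), Literature.Analysis.FluidPDE.IsClassicalNSSolutionOn (Set.Ico 0 T) ν 0 u p →
      Literature.Analysis.FluidPDE.IsLerayHopfOn T ν 0 (u 0) u → Literature.Analysis.FluidPDE.HasRapidSpatialDecay (u 0) →
      ¬ (∀ c₀ : ℝ, 0 < c₀ → c₀ ≤ 1 → ∃ C t₀ : ℝ, t₀ < T ∧ ∀ t ∈ Set.Ioo t₀ T, ∀ j : ℕ,
        (Literature.Analysis.FluidPDE.IsSaturatedLevel c₀ ν (u t) j ∧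
            ∀ k : ℕ, j < k → ¬ Literature.Analysis.FluidPDE.IsSaturatedLevel c₀ ν (u t) k) →
          MeasureTheory.eLpNorm (Literature.Analysis.FunctionSpaces.blockFn (j : ℤ) (u t)) ⊤ MeasureTheory.volume ≤
            ENNReal.ofReal (C * (2 : ℝ) ^ ((3 - (1 : ℝ)) / 2 * (j : ℝ))) *
              MeasureTheory.eLpNorm (Literature.Analysis.FunctionSpaces.blockFn (j : ℤ) (u t)) 2 MeasureTheory.volume) →
      ¬ Filter.Tendsto (fun t => MeasureTheory.eLpNorm (u t - u T) 2 MeasureTheory.volume) (nhdsWithin T (Set.Iio T)) (nhds 0) →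
      ¬ Literature.Analysis.FluidPDE.IsTypeIBlowup u T → Literature.Analysis.FluidPDE.HasSmoothExtensionPast ν 0 u T) := by
  refine ⟨fun h ν T hν hT u p hcl hLH hdec hthick hwild _ => h ν T hν hT u p hcl hLH hdec hthick hwild,
    fun h ν T hν hT u p hcl hLH hdec hthick hwild => h ν T hν hT u p hcl hLH hdec hthick hwild ?_⟩
  exact fun hTI => hwild (tame_of_isTypeIBlowup hν hT hcl hLH hdec hTI)

/-! ## Domination bookkeeping: W₂ under N1 (P2 ∧ J1) and under N32 (P2 ∧ A ∧ B); the Φ-line of X₁ -/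

/-- DOMINATION certificate: W₂ follows from N1's two wild items (no energy atom ∧ atom-free blow-ups are tame ⇒ every first
blow-up is tame ⇒ no wild blob), hence from N32's pieces P2 ∧ A `LinearLocalDefect` ∧ B `LinearDefectIsTame` (J1 = B ∘ A). -/
theorem domination_certificate :
    (NoEnergyAtom ∧ AtomFreeBlowupIsTame → NoWildBlobBlowup) ∧
      (NoEnergyAtom ∧ LinearLocalDefect ∧ LinearDefectIsTame → NoWildBlobBlowup) := by
  have h1 : NoEnergyAtom ∧ AtomFreeBlowupIsTame → NoWildBlobBlowup := by
    rintro ⟨hP2, hJ1⟩ ν T hν hT u p hcl hLH hdec _ hwild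
    by_contra hext
    exact hwild (hJ1 ν T hν hT u p ⟨hcl, hext⟩ hLH hdec (hP2 ν T hν hT u p hcl hLH hdec))
  refine ⟨h1, ?_⟩
  rintro ⟨hP2, hA, hB⟩
  exact h1 ⟨hP2, fun ν T hν hT u p hmax hLH hdec hatom =>
    hB ν T hν hT u p hmax hLH hdec hatom (hA ν T hν hT u p hmax hLH hdec hatom)⟩

/-- The Φ-LINE certificate of X₁ (stmt-27233; arrow form of the registered skeleton `Cruxes.NoThinFrontierBlowup.FrontierFloor`):
`Φ ∧ P2 ∧ J1 → X₁` — a filament-frontier blow-up that did not extend is maximal, atom-free (P2), hence tame (J1), hence has a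
BLOB frontier (Φ): contradiction — together with its Type-I corollary: under Φ every TYPE-I first blow-up has a blob frontier. -/
theorem phiLine_certificate :
    (TameHasBlobFrontier ∧ NoEnergyAtom ∧ AtomFreeBlowupIsTame →
        Summit.NavierStokesRegularity.NavierStokesRegularity.Theses.RootDecompIntermittency.NoThinFrontierBlowup) ∧
      (TameHasBlobFrontier → ∀ (ν T : ℝ), 0 < ν → 0 < T →
        ∀ (u : ℝ → EuclideanSpace ℝ (Fin 3) → EuclideanSpace ℝ (Fin 3)) (p : ℝ → EuclideanSpace ℝ (Fin 3) → ℝ),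
        IsMaximalSmoothSolution ν 0 u p T → IsLerayHopfOn T ν 0 (u 0) u → HasRapidSpatialDecay (u 0) →
        IsTypeIBlowup u T → ¬ (∀ c₀ : ℝ, 0 < c₀ → c₀ ≤ 1 → ∃ C t₀ : ℝ, t₀ < T ∧ ∀ t ∈ Set.Ioo t₀ T, ∀ j : ℕ,
        (Literature.Analysis.FluidPDE.IsSaturatedLevel c₀ ν (u t) j ∧
            ∀ k : ℕ, j < k → ¬ Literature.Analysis.FluidPDE.IsSaturatedLevel c₀ ν (u t) k) →
          MeasureTheory.eLpNorm (Literature.Analysis.FunctionSpaces.blockFn (j : ℤ) (u t)) ⊤ MeasureTheory.volume ≤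
            ENNReal.ofReal (C * (2 : ℝ) ^ ((3 - (1 : ℝ)) / 2 * (j : ℝ))) *
              MeasureTheory.eLpNorm (Literature.Analysis.FunctionSpaces.blockFn (j : ℤ) (u t)) 2 MeasureTheory.volume)) := by
  refine ⟨?_, fun hΦ ν T hν hT u p hmax hLH hdec hTI =>
    hΦ ν T hν hT u p hmax hLH hdec (tame_of_isTypeIBlowup hν hT hmax.1 hLH hdec hTI)⟩
  rintro ⟨hΦ, hP2, hJ1⟩ ν T hν hT u p hcl hLH hdec hthin
  by_contra hext
  exact hΦ ν T hν hT u p ⟨hcl, hext⟩ hLH hdec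
    (hJ1 ν T hν hT u p ⟨hcl, hext⟩ hLH hdec (hP2 ν T hν hT u p hcl hLH hdec)) hthin

end Summit.NavierStokesRegularity.NavierStokesRegularity.Theorems.RootDecompFrontierFloorExactness
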